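import Literature.NumberTheory.EllipticCurves.ManinConstantDeuringTwistProofs
import HarnessLib

/-!
# `‖u‖₂ ≤ 1` at an additive prime `2` of potentially good reduction, for an abstract formal-parameter package
# (lattice-free twin of the tree's `ManinConstantDeuringTwistProofs` §Two) (route `ManinLocalTwoThree`, cruxes C2
# stmt-BirchSwinnertonDyer-22967 / C3 stmt-…-22968; cell bsd-f2-manin, prover p2 gen 25; CES-discharge programme,
# stage 3 step (3c))

The tree's `padicNorm_le_one_of_neronLattice_eq_smul_periodLattice_of_norm_j_le_one_two` proves `‖q‖₂ ≤ 1` for the data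
of the fact `edixhoven_int_of_neronLattice_eq_smul_periodLattice` (`Λ_{L'} = q·Λ₀(f)`) at an additive `2` with `‖j‖₂ ≤ 1`,
by the Deuring twist `exists_deuringTwist_of_norm_j_le_one` (cases (A) ordinary `ā₁'' ≠ 0`, (B) `ā₁'' = 0`, `v < 16`,
(C) `ā₁'' = 0`, `v ≥ 16` with the Newton-polygon vertex) fed to the lattice wrappers `…_of_semistableTwist_sharp/_vertex`,
whose only use of the lattice is the formal parameter `t₀` of `W'`.  THIS FILE states the same theorem for an ABSTRACT
formal-parameter package (`u > 0`, `t₀ ∈ qℚ⟦q⟧`, `[X¹]t₀ = u`, `log_{W'}(t₀) = u·Σ aₙ(W')qⁿ/n`, `t₀, w_{W'}(t₀) ∈ Frac ℤ⟦q⟧`),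
calling the abstract cores `padicNorm_le_one_of_formalLog_subst_eq_of_semistableTwist_sharp/_vertex` directly:

* `padicNorm_le_one_of_formalParam_of_norm_j_le_one_two`.

Proof: the tree's, verbatim (the Honda witness and the `2`-integrality of `Σ aₙXⁿ/n` are free at an additive prime).
Fact-free; standard axioms; no definitions.  BSD is not proved by this file; Manin's conjecture, C2 and C3 are not
proved by this file. [cite: EdixhovenManin1991, Prop. 2] [cite: SilvermanAEC2009, IV.2.3, VII.5.4, VII.5.5, Ex. 7.1,
Appendix A Prop. 1.3] [cite: Honda1970, Thm. 2 (p. 223)]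
-/

set_option autoImplicit false
-- lint-debt: the directory name repeats the summit name (sibling precedent `ManinLocalTwoThreeStevensCurveDatum.lean`)
set_option linter.dupNamespace false

noncomputable section

open scoped Classical IntermediateField

open PowerSeries Literature.RingTheory.FormalGroups Literature.NumberTheory.EllipticCurves
open Literature.NumberTheory.EllipticCurves.ModularForms Literature.NumberTheory.Automorphic
open Literature.NumberTheory.GaloisRepresentations IsLocalRing
open _root_.WeierstrassCurve

namespace Summit.BirchSwinnertonDyer.BirchSwinnertonDyer.Theorems.ManinLocalTwoThree.StevensIntegrality

set_option maxHeartbeats 4000000 in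
/-- **`‖u‖₂ ≤ 1` at an additive prime `2` of potentially good reduction** (`‖j‖₂ ≤ 1`), for an ABSTRACT formal-parameter
package (the tree's `…_of_norm_j_le_one_two` verbatim, its lattice wrappers replaced by the abstract local cores). With
`v = v₂(Δ_min)`, `m = v₂(c₄)` and the Deuring twist `(K, π, e, k, V'')`
(`exists_deuringTwist_of_norm_j_le_one`: `12 ∣ e`, `12k = ve`, `V''` of Deuring shape with good
reduction): (A) if `ā₁'' ≠ 0` (ordinary) then `[z²][2]_{V''}` is a unit and `k < 2e` because
`v ≤ 23` (Kraus); (B) if `ā₁'' = 0` and `v < 16` then `[z⁴][2]_{V''} = ā₃''` is a unit and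
`3k < 4e`; (C) if `ā₁'' = 0` and `v ≥ 16` then Kraus gives `m ≤ 7`, `v₂(j) = 3m − v ≤ 5 < 12`, so
`‖a₁''‖¹² = ‖j‖₂` (`norm_pow_twelve_eq_of_deuring`), i.e. `‖a₁''‖ = ‖π‖^{e(3m − v)/12}`, and the
vertex `(j, v') = (2, e(3m − v)/12)` of the Newton-polygon ender satisfies
`k + v' < 2e ⇔ 3m < 24`. [cite: EdixhovenManin1991, Prop. 2]
[cite: SilvermanAEC2009, IV.2.3, VII.5.4, VII.5.5, Ex. 7.1, Appendix A Prop. 1.3] -/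
theorem padicNorm_le_one_of_formalParam_of_norm_j_le_one_two
    (W' : WeierstrassCurve ℚ) [W'.IsElliptic] [W'.IsGloballyMinimal]
    {u : ℚ} (hCpos : 0 < u) {t₀ : ℚ⟦X⟧} (ht₀0 : constantCoeff t₀ = 0) (ht₀1 : coeff 1 t₀ = u)
    (hlog₀ : W'.formalLog.subst t₀ = C u * PowerSeries.mk fun n ↦ ((W'.LFunction n : ℤ) : ℚ) / n)
    {P' Q' P₂' Q₂' : ℤ⟦X⟧} (hQ' : Q' ≠ 0)
    (hPQ' : t₀ * Q'.map (Int.castRingHom ℚ) = P'.map (Int.castRingHom ℚ)) (hQ₂' : Q₂' ≠ 0)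
    (hPQ₂' : W'.formalW.subst t₀ * Q₂'.map (Int.castRingHom ℚ) = P₂'.map (Int.castRingHom ℚ))
    [hp : Fact (Nat.Prime 2)]
    (hΔ : (2 : ℤ) ∣ minimalDiscriminantInt W') (hc₄ : (2 : ℤ) ∣ (integralModelInt W').c₄)
    (hj : ‖((W'.j : ℚ) : ℚ_[2])‖ ≤ 1) : ‖((u : ℚ) : ℚ_[2])‖ ≤ 1 := by
  have hΔ2 : ((2 : ℕ) : ℤ) ∣ minimalDiscriminantInt W' := by exact_mod_cast hΔ
  have hc₄2 : ((2 : ℕ) : ℤ) ∣ (integralModelInt W').c₄ := by exact_mod_cast hc₄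
  classical
  set v := padicValInt 2 (minimalDiscriminantInt W') with hv_def
  have hv := norm_Δ_eq_inv_pow_padicValInt W' (p := 2)
  obtain ⟨K, hK, πu, e, k, r, s, t, V'', hπe, he, h12e, hke, hV'', hunit, ha₂, ha₄, ha₆⟩ :=
    exists_deuringTwist_of_norm_j_le_one (p := 2) (by norm_num) W' hj hv
  haveI := hK
  have h2R : ((2 : ℕ) : ℝ)⁻¹ = (2 : ℝ)⁻¹ := by norm_num
  -- numerics from Kraus and `‖j‖ ≤ 1`
  have hjΔ : ((W'.j : ℚ) : ℚ_[2]) * ((W'.Δ : ℚ) : ℚ_[2]) = ((W'.c₄ : ℚ) : ℚ_[2]) ^ 3 := by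
    exact_mod_cast j_mul_Δ_eq_c₄_pow W'
  have hc₄norm : ‖((W'.c₄ : ℚ) : ℚ_[2])‖ ^ 3 ≤ ((2 : ℕ) : ℝ)⁻¹ ^ v := by
    rw [← norm_pow, ← hjΔ, norm_mul, hv]
    exact mul_le_of_le_one_left (by positivity) hj
  -- `v ≥ 16 → c₄ ≠ 0 ∧ v₂(c₄) ≤ 7 ∧ v ≤ 3 v₂(c₄)`
  have hbig : 16 ≤ v → (integralModelInt W').c₄ ≠ 0 ∧ padicValInt 2 (integralModelInt W').c₄ ≤ 7 ∧
      v ≤ 3 * padicValInt 2 (integralModelInt W').c₄ := by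
    intro h16
    have hK2 := not_pow_dvd_c₄_minimalDiscriminantInt_two W'
    have hΔ16 : (2 : ℤ) ^ 16 ∣ minimalDiscriminantInt W' := (padicValInt_dvd_iff 16 _).mpr (Or.inr h16)
    have hc₄0 : (integralModelInt W').c₄ ≠ 0 := by
      intro h0; exact hK2 ⟨by rw [h0]; exact dvd_zero _, hΔ16⟩
    have hm7 : padicValInt 2 (integralModelInt W').c₄ ≤ 7 := by
      by_contra hcon
      exact hK2 ⟨(padicValInt_dvd_iff 8 _).mpr (Or.inr (not_le.mp hcon)), hΔ16⟩
    refine ⟨hc₄0, hm7, ?_⟩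
    have hm := norm_c₄_eq_inv_pow_padicValInt W' (p := 2) hc₄0
    rw [hm, ← pow_mul] at hc₄norm
    by_contra hcon
    rw [not_le] at hcon
    have := (pow_lt_pow_iff_right_of_lt_one₀ (by positivity)
      (inv_lt_one_of_one_lt₀ (by norm_num : (1 : ℝ) < (2 : ℕ)))).mpr
      (by generalize padicValInt 2 (integralModelInt W').c₄ = m at hcon ⊢; omega :
        padicValInt 2 (integralModelInt W').c₄ * 3 < v)
    linarith
  have hv23 : v ≤ 23 := by
    by_contra hcon
    obtain ⟨-, hm7, hv3⟩ := hbig (by omega)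
    omega
  -- the residue of `V''`
  letI hOloc : IsLocalRing (padicCoeffRing K) := isLocalRing_padicCoeffRing K
  letI hOch : CharP (ResidueField (padicCoeffRing K)) 2 := charP_residueField_padicCoeffRing K
  set Vr := V''.map (residue (padicCoeffRing K)) with hVr
  have hΔr : Vr.Δ ≠ 0 := by
    rw [hVr, map_Δ]; exact (residue_ne_zero_iff_isUnit _).mpr hunit
  have hra₂ : Vr.a₂ = 0 := by change residue _ V''.a₂ = 0; rw [ha₂, map_zero]
  have hra₄ : Vr.a₄ = 0 := by change residue _ V''.a₄ = 0; rw [ha₄, map_zero]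
  have hra₆ : Vr.a₆ = 0 := by change residue _ V''.a₆ = 0; rw [ha₆, map_zero]
  have hcoeffres : ∀ n, residue (padicCoeffRing K) (coeff n (V''.formalMul 2)) = coeff n (Vr.formalMul 2) := by
    intro n; rw [← PowerSeries.coeff_map, map_formalMul, ← hVr]
  by_cases hra₁ : Vr.a₁ = 0
  · -- supersingular reduction: unit coefficient in degree `4`
    have h4 : IsUnit (coeff 4 (V''.formalMul 2)) := by
      rw [← residue_ne_zero_iff_isUnit, hcoeffres]
      exact coeff_four_formalMul_two_ne_zero Vr hra₁ hra₂ hra₄ hra₆ hΔr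
    by_cases hv16 : v < 16
    · -- (B): `J = 4`, `3k < 4e`
      refine padicNorm_le_one_of_formalLog_subst_eq_of_semistableTwist_sharp W' hCpos ht₀0 ht₀1 hlog₀ hQ' hPQ'
        hQ₂' hPQ₂' (W'.exists_padicInt_formalLog_subst_eq_lSeriesLog_of_dvd_of_dvd hΔ2 hc₄2)
        (W'.norm_coeff_lSeriesLog_le_one_of_dvd_of_dvd 2 hΔ2 hc₄2) K πu hπe r s t V'' hV'' ⟨4, by norm_num, h4, ?_⟩
      have h1 : 3 * (12 * k) < 48 * e := by
        rw [hke, ← mul_assoc]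
        exact Nat.mul_lt_mul_of_pos_right (by omega) he
      omega
    · -- (C): vertex `(2, e(3m − v)/12)`
      rw [not_lt] at hv16
      obtain ⟨hc₄0, hm7, hv3m⟩ := hbig hv16
      set m := padicValInt 2 (integralModelInt W').c₄ with hm_def
      have hm := norm_c₄_eq_inv_pow_padicValInt W' (p := 2) hc₄0
      obtain ⟨e', he'⟩ := h12e
      -- `‖j‖₂ = 2^{-(3m - v)}`
      have hjnorm : ‖((W'.j : ℚ) : ℚ_[2])‖ = ((2 : ℕ) : ℝ)⁻¹ ^ (3 * m - v) := by
        have hΔn0 : ‖((W'.Δ : ℚ) : ℚ_[2])‖ ≠ 0 := by rw [hv]; positivity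
        have h := congrArg (fun x ↦ ‖x‖) hjΔ
        simp only [norm_mul, norm_pow] at h
        rw [hv, hm, ← pow_mul] at h
        -- h : ‖j‖ * 2⁻¹^v = 2⁻¹^(m*3)
        have e1 : ((2 : ℕ) : ℝ)⁻¹ ^ (m * 3) = ((2 : ℕ) : ℝ)⁻¹ ^ (3 * m - v) * ((2 : ℕ) : ℝ)⁻¹ ^ v := by
          rw [← pow_add]; congr 1; omega
        rw [e1] at h
        exact mul_right_cancel₀ (by positivity) h
      -- `‖a₁''‖¹² = ‖j‖₂` on the Deuring model `V''`
      set φQ : ℚ →+* K := algebraMap ℚ K with hφQ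
      have hnormQ : ∀ x : ℚ, ‖((φQ x : K) : PadicAlgCl 2)‖ = ‖(x : ℚ_[2])‖ := fun x ↦ by
        have hφQ' : φQ x = algebraMap ℚ_[2] K (x : ℚ_[2]) := by
          rw [hφQ]
          have : (algebraMap ℚ_[2] K).comp (algebraMap ℚ ℚ_[2]) = algebraMap ℚ K :=
            RingHom.ext fun y ↦ by rw [eq_ratCast, eq_ratCast]
          rw [← this, RingHom.comp_apply, eq_ratCast]
        rw [hφQ', IntermediateField.coe_algebraMap_apply, PadicAlgCl.norm_extends]
      have hjV : φQ W'.j * (V''.map (algebraMap (padicCoeffRing K) K)).Δ =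
          (V''.map (algebraMap (padicCoeffRing K) K)).c₄ ^ 3 := by
        have h :=
          j_mul_Δ_eq_c₄_pow ((⟨πu ^ k, (r : K), (s : K), (t : K)⟩ : VariableChange K) • W'.map φQ)
        rw [WeierstrassCurve.variableChange_j, show (W'.map φQ).j = φQ W'.j from W'.map_j φQ] at h
        rw [hφQ, ← hV''] at h
        exact h
      rw [WeierstrassCurve.map_Δ, WeierstrassCurve.map_c₄] at hjV
      have hc₄V : V''.c₄ = V''.a₁ * (V''.a₁ ^ 3 - 24 * V''.a₃) := by
        rw [WeierstrassCurve.c₄, WeierstrassCurve.b₂, WeierstrassCurve.b₄, ha₂, ha₄]; ring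
      set a1A : PadicAlgCl 2 := (((V''.a₁ : padicCoeffRing K) : K) : PadicAlgCl 2) with ha1A
      set a3A : PadicAlgCl 2 := (((V''.a₃ : padicCoeffRing K) : K) : PadicAlgCl 2) with ha3A
      have hΔ1 : ‖(((V''.Δ : padicCoeffRing K) : K) : PadicAlgCl 2)‖ = 1 :=
        (isUnit_padicCoeffRing_iff K _).mp hunit
      have hjA : ‖((W'.j : ℚ) : ℚ_[2])‖ = ‖a1A * (a1A ^ 3 - 24 * a3A)‖ ^ 3 := by
        rw [hc₄V] at hjV
        have h : ‖(((φQ W'.j * ((V''.Δ : padicCoeffRing K) : K)) : K) : PadicAlgCl 2)‖ =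
            ‖(((((V''.a₁ * (V''.a₁ ^ 3 - 24 * V''.a₃) : padicCoeffRing K)) : K) ^ 3 : K) : PadicAlgCl 2)‖ := by
          have hjV' : φQ W'.j * ((V''.Δ : padicCoeffRing K) : K) =
              (((V''.a₁ * (V''.a₁ ^ 3 - 24 * V''.a₃) : padicCoeffRing K)) : K) ^ 3 := hjV
          rw [hjV']
        have e1 : (((φQ W'.j * ((V''.Δ : padicCoeffRing K) : K)) : K) : PadicAlgCl 2) =
            ((φQ W'.j : K) : PadicAlgCl 2) * (((V''.Δ : padicCoeffRing K) : K) : PadicAlgCl 2) := by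
          push_cast; ring
        have h24 : ((((24 : padicCoeffRing K) : padicCoeffRing K) : K) : PadicAlgCl 2) = 24 := by
          rw [show (24 : padicCoeffRing K) = (1 + 1) ^ 3 * (1 + 1 + 1) by norm_num]
          push_cast; norm_num
        have e2 : (((((V''.a₁ * (V''.a₁ ^ 3 - 24 * V''.a₃) : padicCoeffRing K)) : K) ^ 3 : K) : PadicAlgCl 2) =
            (a1A * (a1A ^ 3 - 24 * a3A)) ^ 3 := by
          push_cast
          rw [h24]
        rw [e1, e2, norm_mul, hΔ1, mul_one, hnormQ, norm_pow] at h
        exact h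
      have h3A : ‖(3 : PadicAlgCl 2)‖ = 1 := by
        rw [← map_ofNat (algebraMap ℚ_[2] (PadicAlgCl 2)) 3]
        change ‖((3 : ℚ_[2]) : PadicAlgCl 2)‖ = 1
        rw [PadicAlgCl.norm_extends, show (3 : ℚ_[2]) = ((3 : ℕ) : ℚ_[2]) by norm_num,
          Padic.norm_natCast_eq_one_iff]
        norm_num
      have h2A : ‖(2 : PadicAlgCl 2)‖ = (2 : ℝ)⁻¹ := by
        rw [← map_ofNat (algebraMap ℚ_[2] (PadicAlgCl 2)) 2]
        change ‖((2 : ℚ_[2]) : PadicAlgCl 2)‖ = (2 : ℝ)⁻¹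
        rw [PadicAlgCl.norm_extends, show (2 : ℚ_[2]) = ((2 : ℕ) : ℚ_[2]) by norm_num, Padic.norm_p]
        norm_num
      have ha3le : ‖a3A‖ ≤ 1 := norm_coe_padicCoeffRing_le K _
      have hpow12 : ‖a1A‖ ^ 12 = ((2 : ℕ) : ℝ)⁻¹ ^ (3 * m - v) := by
        refine norm_pow_twelve_eq_of_deuring h3A ha3le (hjnorm ▸ hjA) ?_
        rw [h2A, ← h2R]
        exact pow_lt_pow_right_of_lt_one₀ (by positivity) (by norm_num) (by omega)
      -- `‖a₁''‖ = ‖π‖^{e'(3m − v)}` with `e = 12e'`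
      have hρ : ‖((πu : K) : PadicAlgCl 2)‖ ^ (e' * (3 * m - v)) = ‖a1A‖ := by
        have h1 : (‖((πu : K) : PadicAlgCl 2)‖ ^ (e' * (3 * m - v))) ^ 12 = ‖a1A‖ ^ 12 := by
          rw [hpow12, ← pow_mul, show e' * (3 * m - v) * 12 = e * (3 * m - v) by rw [he']; ring, pow_mul,
            hπe]
        exact (pow_left_inj₀ (by positivity) (norm_nonneg _) (by norm_num)).mp h1
      have hcoeff2 : (((coeff 2 (V''.formalMul 2) : padicCoeffRing K) : K) : PadicAlgCl 2) = -a1A := by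
        rw [V''.coeff_two_formalMul_two]; push_cast; rfl
      refine padicNorm_le_one_of_formalLog_subst_eq_of_semistableTwist_vertex W' hCpos ht₀0 ht₀1 hlog₀ hQ' hPQ'
        hQ₂' hPQ₂' (W'.exists_padicInt_formalLog_subst_eq_lSeriesLog_of_dvd_of_dvd hΔ2 hc₄2)
        (W'.norm_coeff_lSeriesLog_le_one_of_dvd_of_dvd 2 hΔ2 hc₄2) K πu hπe r s t V'' hV'' ⟨4, by norm_num, h4⟩
        (j := 2) (v := e' * (3 * m - v)) (by norm_num) (by rw [hcoeff2, norm_neg, hρ]) ?_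
      -- `k + e'(3m − v) < 2e` iff `3m < 24`
      obtain ⟨d, hd⟩ := Nat.exists_eq_add_of_le hv3m
      have hsub : 3 * m - v = d := by omega
      have he'0 : 0 < e' := by
        rcases Nat.eq_zero_or_pos e' with h0 | h0
        · rw [h0, mul_zero] at he'; omega
        · exact h0
      have hk : k = e' * v := by
        apply Nat.eq_of_mul_eq_mul_left (by norm_num : 0 < 12)
        rw [hke, he']; ring
      rw [hsub, hk, he']
      calc (2 - 1) * (e' * v) + e' * d = e' * (3 * m) := by rw [hd]; ring
        _ < e' * 24 := Nat.mul_lt_mul_of_pos_left (by omega) he'0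
        _ = 2 * (12 * e') := by ring
  · -- (A): ordinary reduction, `J = 2`, `k < 2e`
    have h2 : IsUnit (coeff 2 (V''.formalMul 2)) := by
      rw [← residue_ne_zero_iff_isUnit, hcoeffres, coeff_two_formalMul_two_of_char_two Vr]
      exact hra₁
    refine padicNorm_le_one_of_formalLog_subst_eq_of_semistableTwist_sharp W' hCpos ht₀0 ht₀1 hlog₀ hQ' hPQ'
      hQ₂' hPQ₂' (W'.exists_padicInt_formalLog_subst_eq_lSeriesLog_of_dvd_of_dvd hΔ2 hc₄2)
      (W'.norm_coeff_lSeriesLog_le_one_of_dvd_of_dvd 2 hΔ2 hc₄2) K πu hπe r s t V'' hV'' ⟨2, by norm_num, h2, ?_⟩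
    have h1 : 12 * k < 24 * e := by
      rw [hke]
      exact Nat.mul_lt_mul_of_pos_right (by omega) he
    omega

end Summit.BirchSwinnertonDyer.BirchSwinnertonDyer.Theorems.ManinLocalTwoThree.StevensIntegrality

end
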